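import Summits.CriticalPhenomena.CardyFormulaZ2.Theorems.CardyBoundaryCoulombGasBoundaryDefectGaussianRStubTransportPathsPart4

/-!
# Stub `stub_transportPaths` of line `rainbow-monomials-in-excursion-kernels` — Part 5:
# uniqueness of germ directions, flat points, straight monotone edges
# (crux `CardyBoundaryCoulombGas.BoundaryDefectGaussianR`, stmt-CriticalPhenomena-14132)

Towards the polygon structure of a rectilinear Jordan frontier (`γ = D.boundary`):

* `tp_out_unique`, `tp_in_unique` — the exponents of the outgoing / incoming germ directions at a
  parameter are unique (mod `4`), so wedge data at a point are canonical;
* `tp_flat_of_two` — a point with `m = 2` is FLAT (frontier locally horizontal or vertical), the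
  converse of `tp_two_of_flat` (Part 4): corners are exactly the non-flat parameters;
* `tp_flat_local`, `tp_const_coord`, `tp_edge_param` — on a parameter interval of flat points of
  length `< 1` the loop is a strictly monotone parametrisation of an axis segment:
  `γ t = γ a + ‖γ t - γ a‖ d`, `d ∈ {1, i, -1, -i}`, `t ↦ ‖γ t - γ a‖` strictly increasing
  (connectedness: the horizontal and vertical local types are open and disjoint; continuity and
  injectivity give strict monotonicity).
All [folklore].
-/

noncomputable section

open Set Filter Metric Topology
open Literature.Probability.RandomPlanarGeometry
open Summit.CriticalPhenomena.CardyFormulaZ2.Cruxes.RectilinearCardy.ExcursionKernelCovariance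

namespace Summit.CriticalPhenomena.CardyFormulaZ2.Cruxes.BoundaryDefectGaussianR.RainbowMonomialsInExcursionKernels

/-! ### Uniqueness of the germ directions -/

/-- **The outgoing direction is unique.** Two straight strictly monotone representations of the
outgoing germ at `t` along `i^a` and `i^a'` (`a, a' < 4`) have `a = a'`. [folklore] -/
theorem tp_out_unique {γ : ℝ → ℂ} {t η η' : ℝ} {a a' : ℕ} (hη : 0 < η) (hη' : 0 < η')
    (ha : a < 4) (ha' : a' < 4)
    (h : ∀ t' ∈ Icc t (t + η), γ t' = γ t + ((‖γ t' - γ t‖ : ℝ) : ℂ) * Complex.I ^ a)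
    (hmono : StrictMonoOn (fun t' => ‖γ t' - γ t‖) (Icc t (t + η)))
    (h' : ∀ t' ∈ Icc t (t + η'), γ t' = γ t + ((‖γ t' - γ t‖ : ℝ) : ℂ) * Complex.I ^ a') :
    a = a' := by
  set s := t + min η η' with hs
  have hm : 0 < min η η' := lt_min hη hη'
  have hs1 : s ∈ Icc t (t + η) := ⟨by rw [hs]; linarith, by rw [hs]; linarith [min_le_left η η']⟩
  have hs2 : s ∈ Icc t (t + η') := ⟨by rw [hs]; linarith, by rw [hs]; linarith [min_le_right η η']⟩
  have hpos : 0 < ‖γ s - γ t‖ := by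
    have h1 := hmono ⟨le_rfl, by linarith⟩ hs1 (by rw [hs]; linarith : t < s)
    simp only [sub_self, norm_zero] at h1
    exact h1
  have heq : ((‖γ s - γ t‖ : ℝ) : ℂ) * Complex.I ^ a = ((‖γ s - γ t‖ : ℝ) : ℂ) * Complex.I ^ a' := by
    have e3 : γ t + ((‖γ s - γ t‖ : ℝ) : ℂ) * Complex.I ^ a =
        γ t + ((‖γ s - γ t‖ : ℝ) : ℂ) * Complex.I ^ a' :=
      calc γ t + ((‖γ s - γ t‖ : ℝ) : ℂ) * Complex.I ^ a = γ s := (h s hs1).symm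
        _ = γ t + ((‖γ s - γ t‖ : ℝ) : ℂ) * Complex.I ^ a' := h' s hs2
    exact add_left_cancel e3
  exact tp_I_pow_inj ha ha' (mul_left_cancel₀ (by exact_mod_cast hpos.ne') heq)

/-- **The incoming direction is unique (mod 4).** Two straight strictly monotone representations
of the incoming germ at `t` along `i^b` and `i^b'` have `b ≡ b' (mod 4)`. [folklore] -/
theorem tp_in_unique {γ : ℝ → ℂ} {t η η' : ℝ} {b b' : ℕ} (hη : 0 < η) (hη' : 0 < η')
    (h : ∀ t' ∈ Icc (t - η) t, γ t' = γ t + ((‖γ t' - γ t‖ : ℝ) : ℂ) * Complex.I ^ b)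
    (hanti : StrictAntiOn (fun t' => ‖γ t' - γ t‖) (Icc (t - η) t))
    (h' : ∀ t' ∈ Icc (t - η') t, γ t' = γ t + ((‖γ t' - γ t‖ : ℝ) : ℂ) * Complex.I ^ b') :
    b % 4 = b' % 4 := by
  set s := t - min η η' with hs
  have hm : 0 < min η η' := lt_min hη hη'
  have hs1 : s ∈ Icc (t - η) t := ⟨by rw [hs]; linarith [min_le_left η η'], by rw [hs]; linarith⟩
  have hs2 : s ∈ Icc (t - η') t :=
    ⟨by rw [hs]; linarith [min_le_right η η'], by rw [hs]; linarith⟩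
  have hpos : 0 < ‖γ s - γ t‖ := by
    have h1 := hanti hs1 ⟨by linarith, le_rfl⟩ (by rw [hs]; linarith : s < t)
    simp only [sub_self, norm_zero] at h1
    exact h1
  have heq : ((‖γ s - γ t‖ : ℝ) : ℂ) * Complex.I ^ b = ((‖γ s - γ t‖ : ℝ) : ℂ) * Complex.I ^ b' := by
    have e3 : γ t + ((‖γ s - γ t‖ : ℝ) : ℂ) * Complex.I ^ b =
        γ t + ((‖γ s - γ t‖ : ℝ) : ℂ) * Complex.I ^ b' :=
      calc γ t + ((‖γ s - γ t‖ : ℝ) : ℂ) * Complex.I ^ b = γ s := (h s hs1).symm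
        _ = γ t + ((‖γ s - γ t‖ : ℝ) : ℂ) * Complex.I ^ b' := h' s hs2
    exact add_left_cancel e3
  have hI : Complex.I ^ b = Complex.I ^ b' := mul_left_cancel₀ (by exact_mod_cast hpos.ne') heq
  rw [Complex.I_pow_eq_pow_mod, Complex.I_pow_eq_pow_mod (n := b')] at hI
  exact tp_I_pow_inj (Nat.mod_lt _ (by norm_num)) (Nat.mod_lt _ (by norm_num)) hI

/-! ### Points with `m = 2` are flat -/

/-- **Two quadrants means flat.** If within `r` of `p` the frontier is the union of the start rays
of the frames `a` and `a + 2`, then every frontier point within `r` of `p` has the imaginary part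
of `p` (`a` even) or the real part of `p` (`a` odd). [folklore] -/
theorem tp_flat_of_two (D : JordanDomain) {p : ℂ} {r : ℝ} {a : ℕ} (hr : 0 < r)
    (hfront : ∀ z, dist z p < r → (z ∈ frontier D.carrier ↔
      (((z - p) * (-Complex.I) ^ a).im = 0 ∧ 0 ≤ ((z - p) * (-Complex.I) ^ a).re) ∨
        (((z - p) * (-Complex.I) ^ (a + 2)).im = 0 ∧
          0 ≤ ((z - p) * (-Complex.I) ^ (a + 2)).re))) :
    ∃ r' : ℝ, 0 < r' ∧
      ((∀ z ∈ frontier D.carrier, dist z p < r' → z.im = p.im) ∨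
        (∀ z ∈ frontier D.carrier, dist z p < r' → z.re = p.re)) := by
  refine ⟨r, hr, ?_⟩
  -- both rays lie on the line `im u = 0`, `u = (z - p)(-i)^a`
  have hline : ∀ z ∈ frontier D.carrier, dist z p < r → ((z - p) * (-Complex.I) ^ a).im = 0 := by
    intro z hz hzr
    rcases (hfront z hzr).1 hz with h | h
    · exact h.1
    · have e : (z - p) * (-Complex.I) ^ (a + 2) = -((z - p) * (-Complex.I) ^ a) := by
        rw [pow_add, neg_pow Complex.I 2, Complex.I_sq]; ring
      have h1 := h.1
      rw [e, Complex.neg_im, neg_eq_zero] at h1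
      exact h1
  have hzp : ∀ z : ℂ, z - p = (z - p) * (-Complex.I) ^ a * Complex.I ^ a := fun z => by
    rw [mul_assoc, neg_I_pow_mul_I_pow, mul_one]
  rcases Nat.even_or_odd a with ⟨k, hk⟩ | ⟨k, hk⟩
  · left
    intro z hz hzr
    have h0 := hline z hz hzr
    have hIa : Complex.I ^ a = (-1) ^ k := by rw [hk, ← two_mul, pow_mul, Complex.I_sq]
    have e := congrArg Complex.im (hzp z)
    rw [hIa] at e
    rcases neg_one_pow_eq_or ℂ k with h1 | h1 <;> rw [h1] at e <;> simp [h0] at e <;> linarith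
  · right
    intro z hz hzr
    have h0 := hline z hz hzr
    have hIa : Complex.I ^ a = (-1) ^ k * Complex.I := by
      rw [hk, pow_succ, pow_mul, Complex.I_sq]
    have e := congrArg Complex.re (hzp z)
    rw [hIa] at e
    rcases neg_one_pow_eq_or ℂ k with h1 | h1 <;> rw [h1] at e <;> simp [h0] at e <;> linarith

/-! ### Straight monotone edges between corners -/

/-- At a flat parameter, locally (in the parameter) one coordinate of the loop is constant.
[folklore] -/
theorem tp_flat_local (D : JordanDomain) {t r : ℝ} (hr : 0 < r)
    (h : (∀ z ∈ frontier D.carrier, dist z (D.boundary t) < r → z.im = (D.boundary t).im) ∨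
      (∀ z ∈ frontier D.carrier, dist z (D.boundary t) < r → z.re = (D.boundary t).re)) :
    ∃ ε : ℝ, 0 < ε ∧ ((∀ s ∈ Ioo (t - ε) (t + ε), (D.boundary s).im = (D.boundary t).im) ∨
      (∀ s ∈ Ioo (t - ε) (t + ε), (D.boundary s).re = (D.boundary t).re)) := by
  obtain ⟨ε, hε, hball⟩ :=
    Metric.continuousAt_iff.1 (D.continuous_boundary.continuousAt (x := t)) r hr
  refine ⟨ε, hε, ?_⟩
  have hw : ∀ s ∈ Ioo (t - ε) (t + ε), dist (D.boundary s) (D.boundary t) < r := fun s hs =>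
    hball (by rw [Real.dist_eq, abs_lt]; constructor <;> linarith [hs.1, hs.2])
  rcases h with h | h
  · exact Or.inl fun s hs => h _ (D.boundary_mem_frontier s) (hw s hs)
  · exact Or.inr fun s hs => h _ (D.boundary_mem_frontier s) (hw s hs)

/-- **One coordinate is constant along a flat parameter interval.** If every parameter of
`(a, b)` is flat, then the imaginary part of the loop is constant on `[a, b]`, or the real part
is (the horizontal and the vertical local type are open conditions, disjoint by injectivity of
the loop, covering the connected interval; continuity extends to the endpoints). [folklore] -/
theorem tp_const_coord (D : JordanDomain) {a b : ℝ} (hab : a < b)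
    (hflat : ∀ t ∈ Ioo a b, ∃ r : ℝ, 0 < r ∧
      ((∀ z ∈ frontier D.carrier, dist z (D.boundary t) < r → z.im = (D.boundary t).im) ∨
        (∀ z ∈ frontier D.carrier, dist z (D.boundary t) < r → z.re = (D.boundary t).re))) :
    (∀ t ∈ Icc a b, (D.boundary t).im = (D.boundary a).im) ∨
      (∀ t ∈ Icc a b, (D.boundary t).re = (D.boundary a).re) := by
  set γ := D.boundary with hγ
  set U : Set ℝ := {t | ∃ ε : ℝ, 0 < ε ∧ ∀ s ∈ Ioo (t - ε) (t + ε), (γ s).im = (γ t).im} with hU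
  set W : Set ℝ := {t | ∃ ε : ℝ, 0 < ε ∧ ∀ s ∈ Ioo (t - ε) (t + ε), (γ s).re = (γ t).re} with hW
  have hUo : IsOpen U := by
    rw [Metric.isOpen_iff]
    rintro t ⟨ε, hε, ht⟩
    refine ⟨ε / 2, half_pos hε, fun t' ht' => ⟨ε / 2, half_pos hε, fun s hs => ?_⟩⟩
    rw [mem_ball, Real.dist_eq, abs_lt] at ht'
    rw [ht s ⟨by linarith [hs.1], by linarith [hs.2]⟩, ht t' ⟨by linarith, by linarith⟩]
  have hWo : IsOpen W := by
    rw [Metric.isOpen_iff]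
    rintro t ⟨ε, hε, ht⟩
    refine ⟨ε / 2, half_pos hε, fun t' ht' => ⟨ε / 2, half_pos hε, fun s hs => ?_⟩⟩
    rw [mem_ball, Real.dist_eq, abs_lt] at ht'
    rw [ht s ⟨by linarith [hs.1], by linarith [hs.2]⟩, ht t' ⟨by linarith, by linarith⟩]
  have hUW : Disjoint U W := by
    rw [Set.disjoint_left]
    rintro t ⟨ε₁, hε₁, h₁⟩ ⟨ε₂, hε₂, h₂⟩
    set ε := min (min ε₁ ε₂) 1 with hεdef
    have hε0 : 0 < ε := lt_min (lt_min hε₁ hε₂) one_pos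
    have hε₁' : ε ≤ ε₁ := (min_le_left _ _).trans (min_le_left _ _)
    have hε₂' : ε ≤ ε₂ := (min_le_left _ _).trans (min_le_right _ _)
    have hε1 : ε ≤ 1 := min_le_right _ _
    have heq : γ (t + ε / 2) = γ t :=
      Complex.ext (h₂ _ ⟨by linarith, by linarith⟩) (h₁ _ ⟨by linarith, by linarith⟩)
    have := tp_injOn_Ico D t ⟨by linarith, by linarith⟩ ⟨le_rfl, by linarith⟩ heq
    linarith
  have hcov : Ioo a b ⊆ U ∪ W := fun t ht => by
    obtain ⟨r, hr, h⟩ := hflat t ht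
    obtain ⟨ε, hε, h'⟩ := tp_flat_local D hr h
    rcases h' with h' | h'
    · exact Or.inl ⟨ε, hε, h'⟩
    · exact Or.inr ⟨ε, hε, h'⟩
  have hmid : (a + b) / 2 ∈ Ioo a b := ⟨by linarith, by linarith⟩
  rcases isPreconnected_Ioo.subset_or_subset hUo hWo hUW hcov with hIU | hIW
  · left
    have key : ∀ t ∈ Ioo a b, ∀ t' ∈ Ioo a b, (γ t).im = (γ t').im := by
      intro t ht t' ht'
      have hlc : IsLocallyConstant (fun x : Ioo a b => (γ x).im) := by
        refine (IsLocallyConstant.iff_eventually_eq _).2 fun x => ?_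
        obtain ⟨ε, hε, hx⟩ := hIU x.2
        refine Metric.eventually_nhds_iff.2 ⟨ε, hε, fun y hy => hx y ?_⟩
        rw [Subtype.dist_eq, Real.dist_eq, abs_lt] at hy
        exact ⟨by linarith [hy.1], by linarith [hy.2]⟩
      haveI : PreconnectedSpace (Ioo a b) := Subtype.preconnectedSpace isPreconnected_Ioo
      exact hlc.apply_eq_of_preconnectedSpace ⟨t, ht⟩ ⟨t', ht'⟩
    have hclosed : IsClosed {t | (γ t).im = (γ ((a + b) / 2)).im} :=
      isClosed_eq (Complex.continuous_im.comp D.continuous_boundary) continuous_const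
    have hsub : Icc a b ⊆ {t | (γ t).im = (γ ((a + b) / 2)).im} := by
      rw [← closure_Ioo hab.ne]
      exact closure_minimal (fun t ht => key t ht _ hmid) hclosed
    intro t ht
    have h1 : (γ t).im = (γ ((a + b) / 2)).im := hsub ht
    have h2 : (γ a).im = (γ ((a + b) / 2)).im := hsub (left_mem_Icc.2 hab.le)
    rw [h1, h2]
  · right
    have key : ∀ t ∈ Ioo a b, ∀ t' ∈ Ioo a b, (γ t).re = (γ t').re := by
      intro t ht t' ht'
      have hlc : IsLocallyConstant (fun x : Ioo a b => (γ x).re) := by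
        refine (IsLocallyConstant.iff_eventually_eq _).2 fun x => ?_
        obtain ⟨ε, hε, hx⟩ := hIW x.2
        refine Metric.eventually_nhds_iff.2 ⟨ε, hε, fun y hy => hx y ?_⟩
        rw [Subtype.dist_eq, Real.dist_eq, abs_lt] at hy
        exact ⟨by linarith [hy.1], by linarith [hy.2]⟩
      haveI : PreconnectedSpace (Ioo a b) := Subtype.preconnectedSpace isPreconnected_Ioo
      exact hlc.apply_eq_of_preconnectedSpace ⟨t, ht⟩ ⟨t', ht'⟩
    have hclosed : IsClosed {t | (γ t).re = (γ ((a + b) / 2)).re} :=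
      isClosed_eq (Complex.continuous_re.comp D.continuous_boundary) continuous_const
    have hsub : Icc a b ⊆ {t | (γ t).re = (γ ((a + b) / 2)).re} := by
      rw [← closure_Ioo hab.ne]
      exact closure_minimal (fun t ht => key t ht _ hmid) hclosed
    intro t ht
    have h1 : (γ t).re = (γ ((a + b) / 2)).re := hsub ht
    have h2 : (γ a).re = (γ ((a + b) / 2)).re := hsub (left_mem_Icc.2 hab.le)
    rw [h1, h2]

/-- **The loop is a monotone axis ray between corners.** If every parameter of `(a, b)` is flat
and `b < a + 1`, then for some exponent `e < 4`: `γ t = γ a + ‖γ t - γ a‖ i^e` on `[a, b]` and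
`t ↦ ‖γ t - γ a‖` is strictly increasing there (one coordinate is constant, the other is
continuous and injective, hence strictly monotone). [folklore] -/
theorem tp_edge_param (D : JordanDomain) {a b : ℝ} (hab : a < b) (hb1 : b < a + 1)
    (hflat : ∀ t ∈ Ioo a b, ∃ r : ℝ, 0 < r ∧
      ((∀ z ∈ frontier D.carrier, dist z (D.boundary t) < r → z.im = (D.boundary t).im) ∨
        (∀ z ∈ frontier D.carrier, dist z (D.boundary t) < r → z.re = (D.boundary t).re))) :
    ∃ e : ℕ, e < 4 ∧
      (∀ t ∈ Icc a b, D.boundary t =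
        D.boundary a + ((‖D.boundary t - D.boundary a‖ : ℝ) : ℂ) * Complex.I ^ e) ∧
      StrictMonoOn (fun t => ‖D.boundary t - D.boundary a‖) (Icc a b) := by
  set γ := D.boundary with hγ
  have hinj : InjOn γ (Icc a b) := (tp_injOn_Ico D a).mono (Icc_subset_Ico_right hb1)
  have ha : a ∈ Icc a b := left_mem_Icc.2 hab.le
  rcases tp_const_coord D hab hflat with him | hre
  · -- horizontal piece
    have hinj' : InjOn (fun t => (γ t).re) (Icc a b) := fun t ht t' ht' h =>
      hinj ht ht' (Complex.ext h (by rw [him t ht, him t' ht']))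
    have hcont : ContinuousOn (fun t => (γ t).re) (Icc a b) :=
      (Complex.continuous_re.comp D.continuous_boundary).continuousOn
    have hdiff : ∀ t ∈ Icc a b, γ t - γ a = (((γ t).re - (γ a).re : ℝ) : ℂ) := fun t ht =>
      Complex.ext (by simp) (by
        simp only [Complex.sub_im, Complex.ofReal_im]
        exact sub_eq_zero.2 (him t ht))
    rcases hcont.strictMonoOn_of_injOn_Icc' hab.le hinj' with hmono | hanti
    · have hnorm : ∀ t ∈ Icc a b, ‖γ t - γ a‖ = (γ t).re - (γ a).re := fun t ht => by
        rw [hdiff t ht, Complex.norm_real, Real.norm_eq_abs,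
          abs_of_nonneg (sub_nonneg.2 (hmono.monotoneOn ha ht ht.1))]
      refine ⟨0, by norm_num, fun t ht => ?_, fun t ht t' ht' htt' => ?_⟩
      · rw [pow_zero, mul_one, hnorm t ht, ← hdiff t ht, add_sub_cancel]
      · simp only [hnorm t ht, hnorm t' ht']
        linarith [hmono ht ht' htt']
    · have hnorm : ∀ t ∈ Icc a b, ‖γ t - γ a‖ = (γ a).re - (γ t).re := fun t ht => by
        rw [hdiff t ht, Complex.norm_real, Real.norm_eq_abs,
          abs_of_nonpos (sub_nonpos.2 (hanti.antitoneOn ha ht ht.1)), neg_sub]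
      refine ⟨2, by norm_num, fun t ht => ?_, fun t ht t' ht' htt' => ?_⟩
      · rw [Complex.I_sq, hnorm t ht, mul_neg_one, ← Complex.ofReal_neg, neg_sub, ← hdiff t ht,
          add_sub_cancel]
      · simp only [hnorm t ht, hnorm t' ht']
        linarith [hanti ht ht' htt']
  · -- vertical piece
    have hinj' : InjOn (fun t => (γ t).im) (Icc a b) := fun t ht t' ht' h =>
      hinj ht ht' (Complex.ext (by rw [hre t ht, hre t' ht']) h)
    have hcont : ContinuousOn (fun t => (γ t).im) (Icc a b) :=
      (Complex.continuous_im.comp D.continuous_boundary).continuousOn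
    have hdiff : ∀ t ∈ Icc a b, γ t - γ a = (((γ t).im - (γ a).im : ℝ) : ℂ) * Complex.I :=
      fun t ht => Complex.ext (by
        simp only [Complex.sub_re, Complex.mul_re, Complex.ofReal_re, Complex.I_re, mul_zero,
          Complex.ofReal_im, Complex.I_im, mul_one, sub_self]
        exact sub_eq_zero.2 (hre t ht)) (by simp)
    rcases hcont.strictMonoOn_of_injOn_Icc' hab.le hinj' with hmono | hanti
    · have hnorm : ∀ t ∈ Icc a b, ‖γ t - γ a‖ = (γ t).im - (γ a).im := fun t ht => by
        rw [hdiff t ht, norm_mul, Complex.norm_I, mul_one, Complex.norm_real, Real.norm_eq_abs,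
          abs_of_nonneg (sub_nonneg.2 (hmono.monotoneOn ha ht ht.1))]
      refine ⟨1, by norm_num, fun t ht => ?_, fun t ht t' ht' htt' => ?_⟩
      · rw [pow_one, hnorm t ht, ← hdiff t ht, add_sub_cancel]
      · simp only [hnorm t ht, hnorm t' ht']
        linarith [hmono ht ht' htt']
    · have hnorm : ∀ t ∈ Icc a b, ‖γ t - γ a‖ = (γ a).im - (γ t).im := fun t ht => by
        rw [hdiff t ht, norm_mul, Complex.norm_I, mul_one, Complex.norm_real, Real.norm_eq_abs,
          abs_of_nonpos (sub_nonpos.2 (hanti.antitoneOn ha ht ht.1)), neg_sub]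
      refine ⟨3, by norm_num, fun t ht => ?_, fun t ht t' ht' htt' => ?_⟩
      · have h3 : Complex.I ^ 3 = -Complex.I := by rw [pow_succ, Complex.I_sq]; ring
        rw [h3, hnorm t ht, mul_neg, ← neg_mul, ← Complex.ofReal_neg, neg_sub, ← hdiff t ht,
          add_sub_cancel]
      · simp only [hnorm t ht, hnorm t' ht']
        linarith [hanti ht ht' htt']

/-- **Registered sub-goal `s7_edgeParam` of stub `stub_transportPaths`** (straight monotone edges
between corners, one-line form of `tp_edge_param`). [folklore] -/
theorem s7_edgeParam : ∀ (D : Literature.Probability.RandomPlanarGeometry.JordanDomain) (a b : ℝ), a < b → b < a + 1 → (∀ t ∈ Set.Ioo a b, ∃ r : ℝ, 0 < r ∧ ((∀ z ∈ frontier D.carrier, dist z (D.boundary t) < r → z.im = (D.boundary t).im) ∨ (∀ z ∈ frontier D.carrier, dist z (D.boundary t) < r → z.re = (D.boundary t).re))) → ∃ e : ℕ, e < 4 ∧ (∀ t ∈ Set.Icc a b, D.boundary t = D.boundary a + ((‖D.boundary t - D.boundary a‖ : ℝ) : ℂ) * Complex.I ^ e) ∧ StrictMonoOn (fun t ↦ ‖D.boundary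 t - D.boundary a‖) (Set.Icc a b) :=
  fun D _ _ hab hb1 hflat => tp_edge_param D hab hb1 hflat

end Summit.CriticalPhenomena.CardyFormulaZ2.Cruxes.BoundaryDefectGaussianR.RainbowMonomialsInExcursionKernels

end
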